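import Summits.PneNP.Statement
import Literature.StrongHypotheses.PneNP
import Literature.Computability.Complexity.CookBridges
import Literature.Computability.Complexity.CircuitClassesUniformProofs
import Literature.Computability.Complexity.NondeterministicProofs
import Literature.Computability.Complexity.ReductionsProofs
import Literature.Computability.Complexity.NegCNFTranscoder
import Literature.Computability.Complexity.ProofComplexityNP
import Literature.Computability.Complexity.PHCollapseNP
import Literature.Computability.Complexity.ExpCollapseOfPEqNP
import Literature.Computability.MetaComplexity.ConstructiveSeparationsNP
import Literature.Computability.Cryptography.OneWayFunctionsPneNP
import Literature.Computability.Cryptography.PseudorandomGeneratorsStretchOne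
import Literature.Computability.FineGrained.SatAlgorithmsProofs
import Literature.Computability.FineGrained.EthOfSeth
import Literature.Barriers.PneNP.NaturalProofsHardPRGStrength
import Literature.Algebra.EuclideanLattices.GapSVPVerifier
import Literature.Computability.Complexity.UTIMEPadding
import Literature.Computability.QuantumComplexity.FactoringUP
import Summits.PneNP.PneNP.Theorems.NPNotSubsetPPoly
import Summits.PneNP.PneNP.Theorems.NPNotSubsetBPP
import Summits.PneNP.PneNP.Theorems.OWFExist
import Summits.PneNP.PneNP.Theorems.IOOWFExist
import Summits.PneNP.PneNP.Theorems.LWENotInBQP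
import Summits.PneNP.PneNP.Theorems.ProofCplxProofcplxGeneratorImpliesNPNeCoNP
import Summits.PneNP.PneNP.Theorems.FeigeSatMemNPCook
import Summits.PneNP.PneNP.Theorems.FeigeFirstMomentUnsat
import Summits.PneNP.PneNP.Theorems.PlantedCliqueAssembly2
import Summits.PneNP.PneNP.Theorems.PlantedCliqueErdosRenyiNoLargeClique
import Summits.PneNP.PneNP.Theorems.KarlinRubinMonotoneBlindDelta
import Summits.PneNP.PneNP.Theorems.KarlinRubinErdosRenyiNoLargeClique
import Summits.PneNP.PneNP.Theorems.KarlinRubinCliqueCircuitsOfNotPneNP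
import Summits.PneNP.PneNP.Theorems.KarlinRubinMonotoneSufficesDecompCensus
import HarnessLib
import HarnessLib.Audit
import HarnessLib.Audit.TribunalTags

/-!
# Strong hypotheses of summit `PneNP` — the BRIDGES `H → PneNP` (D-0034, summit-side registry file)

Companion of `Literature/StrongHypotheses/PneNP.lean` (`Literature.StrongHypotheses.PneNP.*`, the
registry of tagged hypotheses; read its module docstring first). This file

1. tags (`@[strong_hypothesis "PneNP.PneNP"]`) the hypotheses that are declared under `Summits/`
   and therefore cannot be tagged from Literature: the canonical conjecture leaves
   `Summit.PneNP.PneNP.{NPNotSubsetPPoly, NPNotSubsetBPP, OWFExist, IOOWFExist, LWENotInBQP}` (the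
   planted-clique circuit hypotheses `QuasipolyHard` / `PolyHard` of the crux audit
   `Cruxes/MonotoneSuffices/DecompositionAudit.lean` live in an UNBUILT work file that no library
   file can import; they are registered as the verbatim Literature copies
   `PlantedCliqueQuasipolyHard` / `PlantedCliquePolyHard`), and DECLARES one, `NPNeUP` (`NP ≠ UP`,
   Valiant 1976), declared here rather than in `Literature/StrongHypotheses/PneNP.lean` for now — see its docstring;
2. records ONE bridge per registered hypothesis, tagged `@[summit_bridge "PneNP.PneNP"]`, with the
   ROOT problem decl `_root_.PneNP` as conclusion:
   * LANDED (`theorem … : H → PneNP` / `H ↔ PneNP`, sorry-free, composed from theorems already in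
     the tree — most through the proved class bridge
     `Literature.Computability.Complexity.pneNP_shape_of_P_ne_NP` / `pneNP_shape_of_NP_not_subset_P`,
     `PneNP` being by definition the shape `∃ L, L ∈ PNPWave0.NP Bool ∧ L ∉ PNPWave0.P Bool`):
     `NPNotSubsetPPoly`, `NPNotSubsetBPP`, `OWFExist` (both copies), `WeakOWFExist`,
     `NonuniformOWFExist`, `IOOWFExist` (both copies), `PRGExist`, `HardPRGExist`, `ETH`, `SETH`,
     `NPNeCoNP`, `NPNeUP` (with `not_NTIME_id_subset_UTIME_pow_of_npNeUP` / `uLadder_of_npNeUP`, the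
     registered form of the Literature padding lemma `UTIMEPadding.lean`: `NP ≠ UP ⇒ ∀ k,
     NTIME(n) ⊄ UTIME(nᵏ)`, which makes cruxes of the shape "one rung of the unambiguous linear-time
     ladder ⇒ all rungs" kernel-visible as `NP ≠ UP` in costume),
     `TautHasNoPolyBoundedProofSystem`, `PHDoesNotCollapse`, `PHNeSigmaPTwo`, `EXPNeNEXP`,
     `KrajicekGeneratorConjecture`, `FeigeRefutationHypothesis`, `PlantedCliqueConjecture`,
     `GapSVPPolyApproxNotInP`, `PlantedCliqueQuasipolyHard`, and the three criteria `NPNotSubsetP`,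
     `PNeNPClasses`, `SATNotInP` (as `Iff`s);
   * PRINTED (named facts `def HImpliesPneNP : Prop := H → PneNP`, CONVENTIONS §4, to be
     discharged by a prover as `theorem HImpliesPneNP_holds`): `PlantedCliquePolyHard` (nonuniform
     polynomial planted-clique circuit hardness; the argument is the KarlinRubin deciding theorem
     minus its monotone step) and `FactoringNotInP` (`FACT ∈ NP` is not yet a tree fact);
   * NONE: `Summit.PneNP.PneNP.LWENotInBQP` (LWE search hardness against uniform quantum circuits;
     `⇒ P ≠ NP` holds informally — under `P = NP` search-LWE at the registered parameters is solved
     classically by witness search — but no printed source states it in this form and the tree's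
     quantum-circuit model makes it a genuine formalisation task; tagged for the tribunal's
     informational probe only).

Design notes. Bridges are kept at Literature level where possible (class bridge + a discharged
fact) rather than importing route deciding theorems; the exceptions are Feige, PlantedClique
(their `closes` theorems, fed with the two PROVED support items each), Krajíček's generator
(`NP_ne_coNP_of_stretching_generator`) and `PlantedCliqueQuasipolyHard` (route KarlinRubin's `closes`
with the landed `karlinRubin_monotoneSuffices_of_quasipolyHard`, `karlinRubin_monotoneBlind_of_noPolyB2Detector`
and the two proved supports — the composition `pneNP_of_quasipolyHard` of the unbuilt audit file,
re-derived here in ten lines). Every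
hypothesis stated in Literature verbatim as the body of a route decl (`FeigeRefutationHypothesis` =
`Feige.FeigeThesis`, `PlantedCliqueConjecture` = `PlantedClique.PlantedcliqueDetectionHard`,
`KrajicekGeneratorConjecture` = `ProofCplx.ProofcplxKrajicekGenerator`, `GapSVPPolyApproxNotInP` =
`Lattice.LatticeThesis`, `PlantedCliqueQuasipolyHard` = the inline hypothesis of
`karlinRubin_monotoneSuffices_of_quasipolyHard`) is definitionally (indeed syntactically) equal to
it, so the route theorems apply to it unchanged.
-/

namespace Summit.PneNP.StrongHypotheses

open Literature.StrongHypotheses.PneNP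
open Literature.Computability.Complexity Literature.Computability.Cryptography
open Literature.Computability.FineGrained Literature.Computability.MetaComplexity
open Literature.Barriers.PneNP Literature.Algebra.EuclideanLattices
open Summit.PneNP.PneNP.Theorems

/-! ### Summit-side tags (hypotheses declared under `Summits/`) -/

attribute [strong_hypothesis "PneNP.PneNP"] Summit.PneNP.PneNP.NPNotSubsetPPoly
attribute [strong_hypothesis "PneNP.PneNP"] Summit.PneNP.PneNP.NPNotSubsetBPP
attribute [strong_hypothesis "PneNP.PneNP"] Summit.PneNP.PneNP.OWFExist
attribute [strong_hypothesis "PneNP.PneNP"] Summit.PneNP.PneNP.IOOWFExist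
attribute [strong_hypothesis "PneNP.PneNP"] Summit.PneNP.PneNP.LWENotInBQP

/-- OPEN CONJECTURE — **`NP ≠ UP`**: some language in `NP` has no polynomial-time verifier with AT
MOST ONE accepting certificate per input, `Nondeterministic.NP ≠ UP` (Valiant's class `UP`,
`Nondeterministic.lean`: the `NP` verifier condition plus `Set.Subsingleton` of the accepted
certificates; `UP ⊆ NP` is `UP_subset_NP`, `UP = ⋃ₖ UTIME(nᵏ)` is `UP_eq_iUnion_UTIME`). POSED: the
class and the question of its power relative to `P` and `NP` are Valiant's (1976); Hemaspaandra–Rothe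
1997, §1 (arXiv cs/9907033, p. 2) survey the ways "NP parts company with UP" and record as open
whether unambiguous computation has nontrivial time hierarchy theorems. STATUS: open; neither
`NP = UP` nor `NP ≠ UP` is known. Strictly stronger than `P ≠ NP` (`P = NP ⇒ UP ⊆ NP = P ⊆ UP`,
`P_subset_UP`; bridge `npNeUP_implies_PneNP` below), so it is a registered open statement
(CONVENTIONS §4: a `def … : Prop`, never asserted, taken as an explicit hypothesis `(h : NPNeUP)`;
not named-fact debt). It is the TOP of the unambiguous linear-time ladder: `NP ≠ UP ⇒ ∀ k,
NTIME(n) ⊄ UTIME(nᵏ)` (`not_NTIME_id_subset_UTIME_pow_of_npNeUP` below; the Literature padding lemma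
`UTIMEPadding.lean`) and conversely
the whole ladder gives `SAT ∉ ⋃ₖ UTIME(nᵏ) = UP`, i.e. `NP ≠ UP` (barrier ladder
`Literature/Barriers/PneNP/Ladder.lean` §2H R-I1: "multitape: all `c` ⟺ `NP ≠ UP`"). Declared here
rather than in `Literature/StrongHypotheses/PneNP.lean` (where the sibling `NPNeCoNP` lives) only because
that library file is operator-maintained and agent proposals to Literature bounce on gate lint
`literature.conjecture`; the operator may move it there verbatim (the canonical leaf
`Theorems/NPNeUP.lean`, whose text is attached as evidence on item stmt-PneNP-19827, awaits a prover
seat; when it lands this def becomes its alias). Registered because the pre-birth tribunal of route `NtimeNotUnambiguousLadder` (T1 `ca3c09d9c56a312d`, judge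
`fe4be13e14828db8`, 2026-08-27) found the climb crux `LadderClimbU` to be this conjecture in costume
and asked that the kernel be able to see it (t1c).
[cite: Valiant1976] [cite: HemaspaandraRothe1997, §1 (p. 2: NP versus UP; unambiguous time hierarchies open)] [status: open] -/
@[conjecture, strong_hypothesis "PneNP.PneNP"] def NPNeUP : Prop :=
  Nondeterministic.NP ≠ UP

/-! ### Two class-level lemmas used by several bridges -/

/-- `NP ≠ coNP ⇒ P ≠ NP` over the tree's classes: `P = NP` gives `coNP = co P = P = NP`
(`co_P_holds`). [cite: AroraBarakCC2009, §2.6.1] -/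
theorem P_ne_NP_of_NP_ne_coNP (h : Nondeterministic.NP ≠ coNP) : Classes.P ≠ Nondeterministic.NP := by
  intro hPNP
  apply h
  show Nondeterministic.NP = co Nondeterministic.NP
  rw [← hPNP]
  exact co_P_holds.symm

/-- `PH ≠ Σₖᵖ ⇒ P ≠ NP`: under `P = NP`, `NP = coNP`, so `PH = NP = P = Σ₀ᵖ ⊆ Σₖᵖ ⊆ PH`.
[cite: AroraBarakCC2009, Thm. 5.4] -/
theorem P_ne_NP_of_PH_ne_SigmaP {k : ℕ} (h : PH ≠ SigmaP k) : Classes.P ≠ Nondeterministic.NP := by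
  intro hPNP
  have hco : Nondeterministic.NP = coNP := by
    by_contra hne
    exact P_ne_NP_of_NP_ne_coNP hne hPNP
  have hPH : PH = Nondeterministic.NP := PH_eq_NP_of_NP_eq_coNP hco
  refine h (Set.Subset.antisymm ?_ (SigmaP_subset_PH k))
  rw [hPH, ← hPNP, ← SigmaP_zero]
  exact SigmaP_mono_le (Nat.zero_le k)

/-! ### Landed bridges: circuit / probabilistic / cryptographic hypotheses -/

/-- **`NP ⊄ P/poly ⇒ P ≠ NP`** (`P ⊆ P/poly`, `P_subset_PPoly_holds`; Arora–Barak §6.4).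
[cite: AroraBarakCC2009, §6.4] -/
@[summit_bridge "PneNP.PneNP"]
theorem npNotSubsetPPoly_implies_PneNP : Summit.PneNP.PneNP.NPNotSubsetPPoly → _root_.PneNP :=
  fun h => pneNP_shape_of_NP_not_subset_P fun hNP => h (hNP.trans P_subset_PPoly_holds)

/-- **`NP ⊄ BPP ⇒ P ≠ NP`** (`P ⊆ BPP`; `not_NP_subset_P_of_not_NP_subset_BPP`). [cite: Goldreich2001, §1.5.3] -/
@[summit_bridge "PneNP.PneNP"]
theorem npNotSubsetBPP_implies_PneNP : Summit.PneNP.PneNP.NPNotSubsetBPP → _root_.PneNP :=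
  fun h => pneNP_shape_of_NP_not_subset_P (not_NP_subset_P_of_not_NP_subset_BPP h)

/-- **One-way functions ⇒ P ≠ NP** (Literature copy; `pneNP_shape_of_OWFExist`). [cite: Goldreich2001, §2.7.4 Exercise 2] -/
@[summit_bridge "PneNP.PneNP"]
theorem owfExist_implies_PneNP : Literature.Computability.Cryptography.OWFExist → _root_.PneNP :=
  fun h => pneNP_shape_of_OWFExist h

/-- **One-way functions ⇒ P ≠ NP** (canonical leaf `Summit.PneNP.PneNP.OWFExist`, definitionally the
Literature copy). [cite: Goldreich2001, §2.7.4 Exercise 2] -/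
@[summit_bridge "PneNP.PneNP"]
theorem owfExistLeaf_implies_PneNP : Summit.PneNP.PneNP.OWFExist → _root_.PneNP :=
  fun h => pneNP_shape_of_OWFExist h

/-- **Weak one-way functions ⇒ P ≠ NP** (`pneNP_shape_of_WeakOWFExist`). [cite: Goldreich2001, §2.7.4 Exercise 2] -/
@[summit_bridge "PneNP.PneNP"]
theorem weakOWFExist_implies_PneNP : WeakOWFExist → _root_.PneNP :=
  fun h => pneNP_shape_of_WeakOWFExist h

/-- **Non-uniformly one-way functions ⇒ P ≠ NP** (`pneNP_shape_of_NonuniformOWFExist`). [cite: Goldreich2001, §2.7.4 Exercise 2] -/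
@[summit_bridge "PneNP.PneNP"]
theorem nonuniformOWFExist_implies_PneNP : NonuniformOWFExist → _root_.PneNP :=
  fun h => pneNP_shape_of_NonuniformOWFExist h

/-- **Infinitely-often one-way functions ⇒ P ≠ NP** (Literature copy). [cite: Goldreich2001, §2.7.4 Exercise 2] -/
@[summit_bridge "PneNP.PneNP"]
theorem ioowfExist_implies_PneNP : Literature.Computability.Cryptography.IOOWFExist → _root_.PneNP :=
  fun h => pneNP_shape_of_IOOWFExist h

/-- **Infinitely-often one-way functions ⇒ P ≠ NP** (canonical leaf). [cite: Goldreich2001, §2.7.4 Exercise 2] -/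
@[summit_bridge "PneNP.PneNP"]
theorem ioowfExistLeaf_implies_PneNP : Summit.PneNP.PneNP.IOOWFExist → _root_.PneNP :=
  fun h => pneNP_shape_of_IOOWFExist h

/-- **Pseudorandom generators ⇒ P ≠ NP** (`pneNP_shape_of_PRGExist`, through `OWFExist`). [cite: Goldreich2001, §3.3.6 with §2.1] -/
@[summit_bridge "PneNP.PneNP"]
theorem prgExist_implies_PneNP : PRGExist → _root_.PneNP :=
  fun h => pneNP_shape_of_PRGExist h

/-- **SPRNG conjecture / `2^{k^ε}`-hard PRGs in `P/poly` ⇒ P ≠ NP** (`⇒ NP ⊄ P/poly` by the range test,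
`HardPRGExist.not_NP_subset_PPoly`; then `P ⊆ P/poly`). [cite: RazborovRudich1997, §4 (remark after the definition of H(G))] -/
@[summit_bridge "PneNP.PneNP"]
theorem hardPRGExist_implies_PneNP : HardPRGExist → _root_.PneNP :=
  fun h => pneNP_shape_of_NP_not_subset_P fun hNP => h.not_NP_subset_PPoly (hNP.trans P_subset_PPoly_holds)

/-! ### Landed bridges: exponential-time hypotheses -/

/-- **ETH ⇒ P ≠ NP** (`P_ne_NP_of_eth_holds`). [cite: ImpagliazzoPaturiJCSS2001, §1] -/
@[summit_bridge "PneNP.PneNP"]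
theorem eth_implies_PneNP : ETH → _root_.PneNP :=
  fun h => pneNP_shape_of_P_ne_NP (P_ne_NP_of_eth_holds h)

/-- **SETH ⇒ P ≠ NP** (`eth_of_seth_holds`, then ETH). [cite: ImpagliazzoPaturiZaneJCSS2001, §1] -/
@[summit_bridge "PneNP.PneNP"]
theorem seth_implies_PneNP : SETH → _root_.PneNP :=
  fun h => pneNP_shape_of_P_ne_NP (P_ne_NP_of_eth_holds (eth_of_seth_holds h))

/-- **`EXP ≠ NEXP ⇒ P ≠ NP`** (padding; `P_ne_NP_of_EXP_ne_NEXP`). [cite: AroraBarakCC2009, Thm. 2.22] -/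
@[summit_bridge "PneNP.PneNP"]
theorem expNeNEXP_implies_PneNP : EXPNeNEXP → _root_.PneNP :=
  fun h => pneNP_shape_of_P_ne_NP (P_ne_NP_of_EXP_ne_NEXP h)

/-! ### Landed bridges: `NP ≠ coNP`, proof complexity, the polynomial hierarchy -/

/-- **`NP ≠ coNP ⇒ P ≠ NP`.** [cite: AroraBarakCC2009, §2.6.1] -/
@[summit_bridge "PneNP.PneNP"]
theorem npNeCoNP_implies_PneNP : NPNeCoNP → _root_.PneNP :=
  fun h => pneNP_shape_of_P_ne_NP (P_ne_NP_of_NP_ne_coNP h)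

/-! ### Landed bridge: `NP ≠ UP`, and the unambiguous linear-time ladder it sits on top of -/

/-- `NP ≠ UP ⇒ P ≠ NP` over the tree's classes: `P = NP` gives `UP ⊆ NP = P ⊆ UP`
(`UP_subset_NP`, `P_subset_UP`). [cite: Valiant1976] -/
theorem P_ne_NP_of_NP_ne_UP (h : Nondeterministic.NP ≠ UP) : Classes.P ≠ Nondeterministic.NP := by
  intro hPNP
  apply h
  refine Set.Subset.antisymm ?_ UP_subset_NP
  rw [← hPNP]
  exact Literature.Computability.QuantumComplexity.P_subset_UP

/-- **`NP ≠ UP ⇒ P ≠ NP`.** [cite: Valiant1976] [cite: HemaspaandraRothe1997, §1] -/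
@[summit_bridge "PneNP.PneNP"]
theorem npNeUP_implies_PneNP : NPNeUP → _root_.PneNP :=
  fun h => pneNP_shape_of_P_ne_NP (P_ne_NP_of_NP_ne_UP h)

/-- **`NP ≠ UP ⇒` every rung of the unambiguous linear-time ladder: `∀ k, NTIME(n) ⊄ UTIME(nᵏ)`**
— the registered-hypothesis form of the Literature padding lemma
`Literature.Computability.Complexity.not_NTIME_id_subset_UTIME_pow_of_NP_ne_UP` (`UTIMEPadding.lean`:
an inclusion at one `k` gives `NP ⊆ UP` by padding `NP`-languages down into `NTIME(n)` and pulling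
`UP`-membership back along `polyPad`, `preimage_mem_UP`). Conversely the whole ladder gives
`SAT ∉ ⋃ₖ UTIME(nᵏ) = UP` (`UP_eq_iUnion_UTIME`, `SAT_mem_NP_holds`), i.e. `NP ≠ UP`: the ladder's top
IS `NP ≠ UP` (barrier ladder `Literature/Barriers/PneNP/Ladder.lean` §2H R-I1). With this lemma in
scope a route crux of the shape "`NTIME(n) ⊄ UTIME(n)` ⇒ all rungs" (e.g.
`NtimeNotUnambiguousLadder.LadderClimbU`) is closed from the registered hypothesis by
`fun h _ k _ => not_NTIME_id_subset_UTIME_pow_of_npNeUP h k` (tribunal T1, rule (a)).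
[cite: AroraBarakCC2009, §2.6.2 (padding)] [cite: HemaspaandraRothe1997, §1] -/
theorem not_NTIME_id_subset_UTIME_pow_of_npNeUP (h : NPNeUP) (k : ℕ) :
    ¬ (NTIME (fun n => n) ⊆ UTIME (fun n => n ^ k)) :=
  not_NTIME_id_subset_UTIME_pow_of_NP_ne_UP h k

/-- `NPNeUP ⇒ ULadder` in the exact shape of the route decl
`Summit.PneNP.PneNP.Theses.NtimeNotUnambiguousLadder.ULadder` (`∀ c, 1 ≤ c → ¬ (NTIME(n) ⊆ UTIME(nᶜ))`).
[cite: AroraBarakCC2009, §2.6.2 (padding)] -/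
theorem uLadder_of_npNeUP (h : NPNeUP) :
    ∀ c : ℕ, 1 ≤ c → ¬ (NTIME (fun n : ℕ => n) ⊆ UTIME (fun n : ℕ => n ^ c)) :=
  uLadder_of_NP_ne_UP h

/-- **No p-bounded proof system for `TAUT` ⇒ P ≠ NP** (Cook–Reckhow Prop. 1.1,
`NP_eq_coNP_iff_hasPolyBoundedProofSystem_TAUT_holds`, then `NP ≠ coNP`). [cite: CookReckhow1979, §1 Prop. 1.1] -/
@[summit_bridge "PneNP.PneNP"]
theorem tautHasNoPolyBoundedProofSystem_implies_PneNP : TautHasNoPolyBoundedProofSystem → _root_.PneNP :=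
  fun h => npNeCoNP_implies_PneNP fun heq =>
    h (NP_eq_coNP_iff_hasPolyBoundedProofSystem_TAUT_holds.1 heq)

/-- **`PH` does not collapse ⇒ P ≠ NP** (instance `k = 0`, i.e. `PH ≠ P`). [cite: AroraBarakCC2009, Thm. 5.4] -/
@[summit_bridge "PneNP.PneNP"]
theorem phDoesNotCollapse_implies_PneNP : PHDoesNotCollapse → _root_.PneNP :=
  fun h => pneNP_shape_of_P_ne_NP (P_ne_NP_of_PH_ne_SigmaP (h 0))

/-- **`PH ≠ Σ₂ᵖ ⇒ P ≠ NP`.** [cite: AroraBarakCC2009, Thm. 5.4 with Thm. 6.19] -/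
@[summit_bridge "PneNP.PneNP"]
theorem phNeSigmaPTwo_implies_PneNP : PHNeSigmaPTwo → _root_.PneNP :=
  fun h => pneNP_shape_of_P_ne_NP (P_ne_NP_of_PH_ne_SigmaP h)

/-- **Krajíček's generator conjecture ⇒ P ≠ NP** (`⇒ NP ≠ coNP`,
`NP_ne_coNP_of_stretching_generator`). [cite: Krajicek2022, §1 (p. 4)] -/
@[summit_bridge "PneNP.PneNP"]
theorem krajicekGeneratorConjecture_implies_PneNP : KrajicekGeneratorConjecture → _root_.PneNP :=
  fun ⟨_, hg, hlen, hhit⟩ => npNeCoNP_implies_PneNP (NP_ne_coNP_of_stretching_generator hg hlen hhit)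

/-! ### Landed bridges: average-case hypotheses (through the routes' deciding theorems) -/

/-- **Feige's hypothesis ⇒ P ≠ NP**: route `PneNP/Feige`, `Feige.closes` with its two PROVED
supports `feige_satMemNPCook_proof` (SAT ∈ Cook's NP) and `feige_firstMomentUnsat_proof`
(first-moment unsatisfiability above density `log 2 / log (8/7)`). [cite: Feige2002, §1 Hypothesis 1] -/
@[summit_bridge "PneNP.PneNP"]
theorem feigeRefutationHypothesis_implies_PneNP : FeigeRefutationHypothesis → _root_.PneNP :=
  fun h => Summit.PneNP.PneNP.Theses.Feige.closes h feige_satMemNPCook_proof feige_firstMomentUnsat_proof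

/-- **Planted Clique conjecture ⇒ P ≠ NP**: route `PneNP/PlantedClique`, `PlantedClique.closes`
with its two PROVED supports `plantedClique_erdosRenyiNoLargeClique_proof` (first-moment clique
bound for `G(n,1/2)`) and `plantedClique_assembly2_proof` (under `P = NP` an exact clique decider is
a polynomial-time test). [cite: BarakHopkinsKelnerKothariMoitraPotechin2019, §1 Remark 2] -/
@[summit_bridge "PneNP.PneNP"]
theorem plantedCliqueConjecture_implies_PneNP : PlantedCliqueConjecture → _root_.PneNP :=
  fun h => Summit.PneNP.PneNP.Theses.PlantedClique.closes
    plantedClique_erdosRenyiNoLargeClique_proof h plantedClique_assembly2_proof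

/-- **Polynomial-factor `GapSVP` hardness ⇒ P ≠ NP**: `GapSVP_1 ∈ promise-NP`
(`gapSVP_mem_promiseNP_holds`, Aharonov–Regev: "containment in NP is trivial"), so under `P = NP`
its separating `NP` language is in `P` and `GapSVP_1 ∈ promise-P`, contradicting the hypothesis at
the constant (polynomially bounded) factor `γ = 1`. [cite: AharonovRegev2005, §1 p. 2] [cite: MicciancioGoldwasser2002, Ch. 1 §1.2] -/
@[summit_bridge "PneNP.PneNP"]
theorem gapSVPPolyApproxNotInP_implies_PneNP (h : GapSVPPolyApproxNotInP) : _root_.PneNP := by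
  by_contra hne
  have hPNP : Classes.P = Nondeterministic.NP := by
    by_contra h'
    exact hne (pneNP_shape_of_P_ne_NP h')
  obtain ⟨L, hL, hy, hn⟩ := gapSVP_mem_promiseNP_holds (fun _ => (1 : ℝ)) (fun _ => le_rfl)
  refine h (fun _ => (1 : ℝ)) ⟨1, fun n => by simp⟩ (fun _ => le_rfl) ⟨L, ?_, hy, hn⟩
  rw [hPNP]
  exact hL

/-! ### Planted-clique CIRCUIT hypotheses: `PlantedCliqueQuasipolyHard` landed, `PlantedCliquePolyHard` printed -/

/-- `n^d < n^⌊log₂ n⌋` once `n ≥ 2^{d+1}` (as in the audit file). [folklore] -/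
theorem pow_lt_pow_log {d n : ℕ} (hn : 2 ^ (d + 1) ≤ n) : n ^ d < n ^ (Nat.log 2 n) := by
  have hn2 : 2 ≤ n := le_trans (by calc 2 = 2 ^ 1 := rfl
    _ ≤ 2 ^ (d + 1) := Nat.pow_le_pow_right (by norm_num) (by omega)) hn
  have hL : d + 1 ≤ Nat.log 2 n := Nat.le_log_of_pow_le (by norm_num) hn
  exact Nat.pow_lt_pow_right hn2 (by omega)

/-- **QPH ⇒ PolyHard** (a polynomial-size detecting family would have `n^⌊log₂ n⌋ ≤ n^{c₀ c}`
eventually, false from `n = 2^{c₀c+1}` on); verbatim `polyHard_of_quasipolyHard` of the audit file,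
restated over the Literature copies. [folklore] -/
theorem plantedCliquePolyHard_of_quasipolyHard (h : PlantedCliqueQuasipolyHard) : PlantedCliquePolyHard := by
  intro δ hδ hδ' c₀ ⟨C, hC, hT⟩
  obtain ⟨c, hc⟩ := h δ hδ hδ'
  have hbig := hc C (hC.mono fun n hn => hn.1) hT
  obtain ⟨n, hn1, hn2, hn3⟩ :=
    (hbig.and (hC.and (Filter.eventually_ge_atTop (2 ^ (c₀ * c + 1))))).exists
  have hle : n ^ (Nat.log 2 n) ≤ n ^ (c₀ * c) :=
    hn1.trans ((Nat.pow_le_pow_left hn2.2 c).trans (by rw [← pow_mul]))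
  exact absurd hle (not_le.2 (pow_lt_pow_log hn3))

/-- **`PlantedCliqueQuasipolyHard ⇒ P ≠ NP`**: route KarlinRubin's deciding theorem `closes` fed with
`MonotoneSuffices` (`karlinRubin_monotoneSuffices_of_quasipolyHard`, landed — its hypothesis is this
statement verbatim), `MonotoneBlind` (`karlinRubin_monotoneBlind_of_noPolyB2Detector` applied to
`plantedCliquePolyHard_of_quasipolyHard`) and the two PROVED supports
`karlinRubin_erdosRenyiNoLargeClique_proof`, `cliqueCircuitsOfNotPneNP_proof`. (This is the
composition `pneNP_of_quasipolyHard` of the unbuilt audit file, over built modules.) [folklore] -/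
@[summit_bridge "PneNP.PneNP"]
theorem plantedCliqueQuasipolyHard_implies_PneNP (h : PlantedCliqueQuasipolyHard) : _root_.PneNP :=
  -- route KarlinRubin was retired (2026-08-17T16:17Z) and its route file no longer carries `closes`;
  -- the same conclusion via the landed census chain `PlantedCliquePolyHard (= PolyHardB2) → PneNP`
  -- (`Theorems.pneNP_of_polyHardB2`, module KarlinRubinMonotoneSufficesDecompCensus: under `¬ PneNP`
  -- the uniform clique circuits `cliqueCircuitsOfNotPneNP_proof` strongly detect the planted
  -- `⌈n^{1/4}⌉`-clique against `karlinRubin_erdosRenyiNoLargeClique_proof`, contradicting δ = 1/4).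
  Summit.PneNP.PneNP.Theorems.pneNP_of_polyHardB2 (plantedCliquePolyHard_of_quasipolyHard h)

/-- PRINTED bridge — **`PlantedCliquePolyHard ⇒ P ≠ NP`**: if for every `δ ∈ (0,1/2)` and every `c`
no `B₂`-circuit family of size `≤ n^c` strongly detects the planted `⌈n^{1/2-δ}⌉`-clique, then
`P ≠ NP`. Proof (in tree pieces): under `¬ PneNP`, `CLIQUE ∈ NP ⊆ P ⊆ P/poly` gives `B₂`-circuits
with `≤ n^{c₁}` gates computing `CLIQUE(n, t)` uniformly in `t ≤ n` (`cliqueCircuitsOfNotPneNP_proof`,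
item stmt-PneNP-18051); at `t = ⌈n^{1/4}⌉` (`δ = 1/4`) this family accepts every planted instance
(the planted set is a `t`-clique) and accepts `G(n,1/2)` with probability `→ 0`
(`karlinRubin_erdosRenyiNoLargeClique_proof`, as `⌈n^{1/4}⌉ ≥ 3 log₂ n` eventually), i.e. it
strongly detects — contradicting the hypothesis at `(1/4, c₁)`. This is `KarlinRubin.closes` with
its monotone-simulation step deleted (Barak et al. 2019, §1 Remark 2: given an exact clique solver,
detection is immediate). [cite: BarakHopkinsKelnerKothariMoitraPotechin2019, §1 Remark 2] -/
@[summit_bridge "PneNP.PneNP"]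
def PlantedCliquePolyHardImpliesPneNP : Prop :=
  PlantedCliquePolyHard → _root_.PneNP

/-- PRINTED bridge — **factoring not in `P` ⇒ P ≠ NP**: `FACT = {⟨N, k⟩ : N has a prime factor ≤ k}`
is in `NP` (guess a prime factor `p ≤ k` of `N`, verify `p ∣ N` and primality — or just `p ∣ N`,
`1 < p ≤ k`, since a divisor `≤ k` yields a prime divisor `≤ k`; Arora–Barak 2009, Example 2.3), so
`P = NP` (as `Classes.P = Nondeterministic.NP`, criterion `PNeNPClasses`) would put `FACT ∈ P`,
i.e. `FactInP`. To discharge: prove `FACT ∈ Nondeterministic.NP` over the tree's `natPairEncoding`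
(a polynomial-time checking relation "`p ∣ N ∧ 1 < p ∧ p ≤ k`" on binary codes) and conclude with
`pneNP_shape_of_P_ne_NP`. [cite: AroraBarakCC2009, Example 2.3 (p. 40) and §2.1] -/
@[summit_bridge "PneNP.PneNP"]
def FactoringNotInPImpliesPneNP : Prop :=
  FactoringNotInP → _root_.PneNP

/-! ### Landed criteria (`E ↔ PneNP`) -/

/-- **`NP ⊄ P` (tree classes) `↔ PneNP`** (model bridges `p_bool_eq`, `CookBridges.np_bool_eq`,
`P ⊆ NP`). [cite: CookClay2006, §1] -/
@[summit_bridge "PneNP.PneNP"]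
theorem npNotSubsetP_iff_pneNP : NPNotSubsetP ↔ _root_.PneNP :=
  ⟨pneNP_shape_of_NP_not_subset_P,
    fun h hsub => P_ne_NP_of_pneNP_shape h (Set.Subset.antisymm P_subset_NP_holds hsub)⟩

/-- **`Classes.P ≠ Nondeterministic.NP ↔ PneNP`** (`pneNP_shape_iff_P_ne_NP`). [cite: CookClay2006, §1] -/
@[summit_bridge "PneNP.PneNP"]
theorem pNeNPClasses_iff_pneNP : PNeNPClasses ↔ _root_.PneNP :=
  pneNP_shape_iff_P_ne_NP.symm

/-- **`SAT ∉ P ↔ PneNP`** (Cook–Levin: `isNPComplete_SAT_holds`, `SAT_mem_NP_holds`,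
`NP_subset_P_of_isNPComplete_of_mem_P`, `P ⊆ NP`). [cite: AroraBarakCC2009, Thm. 2.10 with Thm. 2.8(3)] -/
@[summit_bridge "PneNP.PneNP"]
theorem satNotInP_iff_pneNP : SATNotInP ↔ _root_.PneNP := by
  refine Iff.trans ?_ pneNP_shape_iff_P_ne_NP.symm
  constructor
  · intro h hPNP
    apply h
    show SAT ∈ Classes.P
    rw [hPNP]
    exact SAT_mem_NP_holds
  · intro h hSAT
    exact h (Set.Subset.antisymm P_subset_NP_holds
      (NP_subset_P_of_isNPComplete_of_mem_P isNPComplete_SAT_holds hSAT))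

end Summit.PneNP.StrongHypotheses
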